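import Literature.Analysis.FluidPDE.TaoWhitneyKernel
import Mathlib.Analysis.Convex.Jensen
import Mathlib.Analysis.Convex.Mul
import HarnessLib

/-!
# Tao (2011/2013), proof of Thm. 10.1: the chaining argument along radial rays

Support file for the discharge of the nonlinear estimate `Y₆` of Tao 2011, §10 (arXiv:1108.1165,
proof of Thm. 10.1 = arXiv Thm. 59, pp. 32–33): the control of the term
`c^{-0.1}δ² Σᵢ rᵢ⁴ wᵢ³` ("trickier to handle") by the **parent-ball chaining argument**: "for any
small ball `Bᵢ`, we may assign a "parent" ball `B_{p(i)}` which touches the ball but has radius at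
least `1.001` as large as that of `Bᵢ`. We may iterate this until we reach a large ball `B_{a(i)}`,
and write `wᵢ ≤ w_{a(i)} + Σ_{k ≥ 0} |w_{p^k(i)} − w_{p^{k+1}(i)}|` […] Taking cubes and using
Hölder's inequality, we obtain `wᵢ³ ≲ w_{a(i)}³ + Σ_{k≥0} (1+k)^{10} |w_{p^k(i)} − w_{p^{k+1}(i)}|³`"
combined with the sup bound (10.23) (once) and the Poincaré comparison (10.24) (twice):
"`|wⱼ − w_{p(j)}|³ ≲ c^{0.05}δ⁻¹W^{1/2}rⱼ⁻³ ∫_{10Bⱼ} |∇ω|²`".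

In the continuous Whitney decomposition of `TaoWhitneyKernel` the chain of a point `y` at depth
`d` runs along the inward radial ray `s ↦ y + s v`, and the local averages are the moving ball
averages `m(s)² = ⨍_{B̄(y + sv, 0.06(d+s))} |ω|²`. This file proves:

* `chain_cube_le` — **the abstract chaining lemma** (pure real analysis): if `m ≥ 0` on `[0, L]`
  satisfies the variation bound `|m(s') − m(s)| ≤ ∫ₛ^{s'} g` and the sup bound
  `m(s) ≤ A/(d + s)²`, then `m(0)³ ≤ 4 m(L)³ + 64 A d⁻¹ ∫₀ᴸ g²` (dyadic telescoping
  `m(0) ≤ m(L) + Σⱼ Dⱼ`, `Dⱼ³ ≤ Dⱼ · Dⱼ² ≤ A(2ʲd)⁻² · 2ʲd ∫ g²`, and Jensen for the cube of the sum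
  with weights `2^{-j/2}`) — the printed "taking cubes and using Hölder", "(10.23) once and
  (10.24) twice";
* `abs_sqrt_sub_sqrt_le_integral` — the variation bound for `√A` from `|A'| ≤ 2√A g`;
* the moving ball averages of `|ω|²` along a ray: change of variables to the unit ball
  (`setIntegral_unitBall_comp_add_smul`), differentiation under the integral
  (`hasDerivAt_integral_unitBall_ray`), and the resulting variation bound
  (`abs_sqrt_ballMean_sub_le`, replacing the Poincaré comparison of adjacent averages by the
  fundamental theorem of calculus);
* `ray_chain_cube_le` — **the chain bound for one ray**.

## Mathlib / tree search

Mathlib: `ConvexOn.map_sum_le` + `convexOn_pow` (Jensen), `geom_sum_eq`,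
`intervalIntegral.sum_integral_adjacent_intervals`, `intervalIntegral.integral_eq_sub_of_hasDerivAt`,
`hasDerivAt_integral_of_dominated_loc_of_deriv_le`, `continuous_parametric_integral_of_continuous`,
`Measure.integral_comp_smul`, `integral_add_left_eq_self`; tree: `PoincareBall` (the Poincaré
inequality on balls, not needed in this continuous form of the chain), `TaoWhitneyKernel`.

## References

* T. Tao, *Localisation and compactness properties of the Navier–Stokes global regularity
  problem*, Anal. PDE 6 (2013) 25–107 = arXiv:1108.1165 (`Tao2011`), §10, proof of Thm. 10.1
  (the chaining argument, arXiv pp. 32–33, (10.22)–(10.24)).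
-/

noncomputable section

open MeasureTheory Set Function Filter Metric Topology intervalIntegral
open scoped ENNReal NNReal RealInnerProductSpace

namespace Literature.Analysis.FluidPDE

/-- Local notation for physical space `ℝ³ = EuclideanSpace ℝ (Fin 3)`. -/
local notation "ℝ³" => EuclideanSpace ℝ (Fin 3)

/-! ## The abstract chaining lemma -/

section OneDim

/-- The dyadic chain times `tⱼ = min((2ʲ − 1)d, L)` (depths `d + tⱼ = 2ʲd` until the chain is
stopped at `L`). [folklore] -/
def chainTime (d L : ℝ) (j : ℕ) : ℝ := min ((2 ^ j - 1) * d) L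

variable {d L : ℝ}

/-- Unfolding. [folklore] -/
theorem chainTime_def (d L : ℝ) (j : ℕ) : chainTime d L j = min ((2 ^ j - 1) * d) L := rfl

/-- `t₀ = 0`. [folklore] -/
theorem chainTime_zero (hL : 0 ≤ L) : chainTime d L 0 = 0 := by
  rw [chainTime_def, pow_zero, sub_self, zero_mul, min_eq_left hL]

/-- `tⱼ ≤ L`. [folklore] -/
theorem chainTime_le (d L : ℝ) (j : ℕ) : chainTime d L j ≤ L := min_le_right _ _

/-- `tⱼ ≥ 0`. [folklore] -/
theorem chainTime_nonneg (hd : 0 ≤ d) (hL : 0 ≤ L) (j : ℕ) : 0 ≤ chainTime d L j :=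
  le_min (mul_nonneg (sub_nonneg.2 (one_le_pow₀ (by norm_num))) hd) hL

/-- The chain times increase. [folklore] -/
theorem chainTime_le_succ (hd : 0 ≤ d) (j : ℕ) : chainTime d L j ≤ chainTime d L (j + 1) := by
  rw [chainTime_def, chainTime_def]
  refine min_le_min ?_ le_rfl
  have : (2 : ℝ) ^ j ≤ 2 ^ (j + 1) := pow_le_pow_right₀ (by norm_num) (Nat.le_succ j)
  nlinarith

/-- The chain times increase. [folklore] -/
theorem chainTime_mono (hd : 0 ≤ d) : Monotone (chainTime d L) :=
  monotone_nat_of_le_succ (chainTime_le_succ hd)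

/-- Consecutive chain times differ by at most `2ʲ d`. [folklore] -/
theorem chainTime_succ_sub_le (hd : 0 ≤ d) (j : ℕ) :
    chainTime d L (j + 1) - chainTime d L j ≤ 2 ^ j * d := by
  rw [chainTime_def, chainTime_def]
  have e : ((2 : ℝ) ^ (j + 1) - 1) * d = (2 ^ j - 1) * d + 2 ^ j * d := by ring
  rw [e]
  have h2 : 0 ≤ (2 : ℝ) ^ j * d := by positivity
  rcases le_total ((2 ^ j - 1) * d + 2 ^ j * d) L with h | h
  · rw [min_eq_left h, min_eq_left (by linarith)]
    linarith
  · rw [min_eq_right h]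
    have := min_le_right ((2 ^ j - 1) * d) L
    rcases le_total ((2 ^ j - 1) * d) L with h' | h'
    · rw [min_eq_left h']; linarith
    · rw [min_eq_right h']; linarith

/-- Before the chain is stopped the depth is dyadic: `tⱼ < L` implies `d + tⱼ = 2ʲ d`. [folklore] -/
theorem add_chainTime_eq_of_lt {j : ℕ} (h : chainTime d L j < L) : d + chainTime d L j = 2 ^ j * d := by
  rw [chainTime_def] at h ⊢
  rcases min_choice ((2 ^ j - 1) * d) L with h1 | h1
  · rw [h1]; ring
  · rw [h1] at h; exact absurd h (lt_irrefl _)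

/-- The chain is eventually stopped: `t_N = L` for some `N`. [folklore] -/
theorem exists_chainTime_eq (hd : 0 < d) : ∃ N : ℕ, chainTime d L N = L := by
  obtain ⟨N, hN⟩ := pow_unbounded_of_one_lt (L / d + 1) (by norm_num : (1 : ℝ) < 2)
  refine ⟨N, min_eq_right ?_⟩
  have : L / d < 2 ^ N - 1 := by linarith
  rw [div_lt_iff₀ hd] at this
  linarith

/-- **Cauchy–Schwarz for an interval integral**: `(∫ₐᵇ g)² ≤ (b − a) ∫ₐᵇ g²` for `g` continuous on
`[a, b]` (from `∫ (g − ḡ)² ≥ 0`). [folklore] -/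
theorem sq_intervalIntegral_le {g : ℝ → ℝ} {a b : ℝ} (hab : a ≤ b) (hg : ContinuousOn g (Icc a b)) :
    (∫ x in a..b, g x) ^ 2 ≤ (b - a) * ∫ x in a..b, g x ^ 2 := by
  rcases eq_or_lt_of_le hab with rfl | hab'
  · simp
  have hba : 0 < b - a := sub_pos.2 hab'
  have hgi : IntervalIntegrable g volume a b := (hg.mono (by rw [uIcc_of_le hab])).intervalIntegrable
  have hg2i : IntervalIntegrable (fun x => g x ^ 2) volume a b :=
    ((hg.pow 2).mono (by rw [uIcc_of_le hab])).intervalIntegrable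
  set I := ∫ x in a..b, g x with hI
  set μ := I / (b - a) with hμ
  -- `0 ≤ ∫ (g - μ)² = ∫ g² - 2μI + μ²(b - a)`
  have h0 : 0 ≤ ∫ x in a..b, (g x - μ) ^ 2 :=
    intervalIntegral.integral_nonneg hab fun x _ => sq_nonneg _
  have he : ∫ x in a..b, (g x - μ) ^ 2 = (∫ x in a..b, g x ^ 2) - 2 * μ * I + μ ^ 2 * (b - a) := by
    have e1 : (fun x => (g x - μ) ^ 2) = fun x => g x ^ 2 - (2 * μ) * g x + μ ^ 2 := by
      funext x; ring
    rw [e1, intervalIntegral.integral_add (hg2i.sub (hgi.const_mul _)) (intervalIntegrable_const),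
      intervalIntegral.integral_sub hg2i (hgi.const_mul _), intervalIntegral.integral_const_mul,
      intervalIntegral.integral_const, smul_eq_mul, ← hI]
    ring
  rw [he, hμ] at h0
  have : (∫ x in a..b, g x ^ 2) - I ^ 2 / (b - a) ≥ 0 := by
    have e2 : (∫ x in a..b, g x ^ 2) - 2 * (I / (b - a)) * I + (I / (b - a)) ^ 2 * (b - a) =
        (∫ x in a..b, g x ^ 2) - I ^ 2 / (b - a) := by field_simp; ring
    linarith [e2]
  rw [ge_iff_le, sub_nonneg, div_le_iff₀ hba] at this
  linarith

/-- **Jensen for the cube of a sum with geometric weights**: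
`(Σ_{j<N} Dⱼ)³ ≤ 16 Σ_{j<N} 2ʲ Dⱼ³` for `Dⱼ ≥ 0` (weights `2^{-j/2}`, whose sum is below `4`). This
is the "taking cubes and using Hölder's inequality" step. [cite: Tao2011, §10, proof of Thm. 10.1 ("Taking cubes and using Hölder's inequality")] -/
theorem cube_sum_le (N : ℕ) {D : ℕ → ℝ} (hD : ∀ j, 0 ≤ D j) :
    (∑ j ∈ Finset.range N, D j) ^ 3 ≤ 16 * ∑ j ∈ Finset.range N, 2 ^ j * D j ^ 3 := by
  rcases Nat.eq_zero_or_pos N with rfl | hN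
  · simp
  -- the weights `c j = (√2)⁻ʲ`, `(c j)² = 2⁻ʲ`
  set s : ℝ := (Real.sqrt 2)⁻¹ with hs
  have hs0 : 0 < s := inv_pos.2 (Real.sqrt_pos.2 two_pos)
  have hs2 : s ^ 2 = 2⁻¹ := by rw [hs, inv_pow, Real.sq_sqrt zero_le_two]
  have hs1 : s ≤ 3 / 4 := by
    have h1 : (4 / 3 : ℝ) ≤ Real.sqrt 2 := by
      rw [Real.le_sqrt (by norm_num) (by norm_num)]; norm_num
    calc s = (Real.sqrt 2)⁻¹ := hs
      _ ≤ (4 / 3 : ℝ)⁻¹ := inv_anti₀ (by norm_num) h1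
      _ = 3 / 4 := by norm_num
  have hs1' : s < 1 := by linarith
  set c : ℕ → ℝ := fun j => s ^ j with hc
  have hc0 : ∀ j, 0 < c j := fun j => pow_pos hs0 j
  have hc2 : ∀ j, (c j) ^ 2 = (2 ^ j)⁻¹ := fun j => by
    rw [hc]; change (s ^ j) ^ 2 = _; rw [← pow_mul, mul_comm, pow_mul, hs2, inv_pow]
  set Z : ℝ := ∑ j ∈ Finset.range N, c j with hZ
  have hZ0 : 0 < Z := Finset.sum_pos (fun j _ => hc0 j) (Finset.nonempty_range_iff.2 hN.ne')
  have hZ4 : Z ≤ 4 := by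
    have hgeom : Z = (s ^ N - 1) / (s - 1) := by rw [hZ]; exact geom_sum_eq hs1'.ne N
    rw [hgeom, div_le_iff_of_neg (by linarith), show (4 : ℝ) * (s - 1) = -(4 * (1 - s)) by ring]
    have : 0 ≤ s ^ N := pow_nonneg hs0.le N
    nlinarith
  -- Jensen with weights `c j / Z` at the points `Z D j / c j`
  have hJ := (convexOn_pow 3).map_sum_le (t := Finset.range N) (w := fun j => c j / Z)
    (p := fun j => Z * D j / c j) (fun j _ => (div_pos (hc0 j) hZ0).le)
    (by rw [← Finset.sum_div, ← hZ, div_self hZ0.ne']) (fun j _ => by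
      change 0 ≤ Z * D j / c j; exact div_nonneg (mul_nonneg hZ0.le (hD j)) (hc0 j).le)
  have e1 : ∑ j ∈ Finset.range N, (c j / Z) • (Z * D j / c j) = ∑ j ∈ Finset.range N, D j :=
    Finset.sum_congr rfl fun j _ => by rw [smul_eq_mul]; field_simp [(hc0 j).ne', hZ0.ne']
  have e2 : ∑ j ∈ Finset.range N, (c j / Z) • (fun x : ℝ => x ^ 3) (Z * D j / c j) =
      Z ^ 2 * ∑ j ∈ Finset.range N, 2 ^ j * D j ^ 3 := by
    rw [Finset.mul_sum]
    refine Finset.sum_congr rfl fun j _ => ?_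
    have h2j : (2 : ℝ) ^ j = ((c j) ^ 2)⁻¹ := by rw [hc2, inv_inv]
    rw [smul_eq_mul, h2j]
    field_simp [(hc0 j).ne', hZ0.ne']
  rw [e1, e2] at hJ
  change (∑ j ∈ Finset.range N, D j) ^ 3 ≤ _ at hJ
  refine hJ.trans ?_
  have hS0 : 0 ≤ ∑ j ∈ Finset.range N, 2 ^ j * D j ^ 3 :=
    Finset.sum_nonneg fun j _ => mul_nonneg (by positivity) (pow_nonneg (hD j) 3)
  nlinarith [mul_le_mul hZ4 hZ4 hZ0.le (by norm_num : (0:ℝ) ≤ 4)]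

/-- **The abstract chaining lemma** (Tao's parent-ball chain, made one-dimensional). Let `m ≥ 0`
on `[0, L]` satisfy the variation bound `|m(s') − m(s)| ≤ ∫ₛ^{s'} g` (`g ≥ 0` continuous; in the
application, `g² ∼` the local average of `|∇ω|²` — the Poincaré comparison (10.24)) and the sup
bound `m(s) ≤ A/(d + s)²` (in the application, (10.23): `wᵢ ≲ c^{0.05}δ⁻¹W^{1/2}rᵢ⁻²`). Then
`m(0)³ ≤ 4 m(L)³ + 64 A d⁻¹ ∫₀ᴸ g²`: telescoping over the dyadic times `tⱼ`, each difference
`Dⱼ = |m(t_{j+1}) − m(tⱼ)|` obeys `Dⱼ ≤ A(2ʲd)⁻²` (sup bound, once) and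
`Dⱼ² ≤ 2ʲd ∫_{tⱼ}^{t_{j+1}} g²` (variation bound, twice, with Cauchy–Schwarz), so
`2ʲ Dⱼ³ ≤ A d⁻¹ ∫_{tⱼ}^{t_{j+1}} g²`, and `(Σ Dⱼ)³ ≤ 16 Σ 2ʲ Dⱼ³`. [cite: Tao2011, §10, proof of Thm. 10.1 (the chaining argument, "(10.23) (once) and (10.24) (twice)")] -/
theorem chain_cube_le {m g : ℝ → ℝ} {d L A : ℝ} (hd : 0 < d) (hL : 0 ≤ L) (hA : 0 ≤ A)
    (hm0 : ∀ s ∈ Icc 0 L, 0 ≤ m s) (hm2 : ∀ s ∈ Icc 0 L, m s ≤ A / (d + s) ^ 2)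
    (hg : ContinuousOn g (Icc 0 L))
    (hm1 : ∀ s ∈ Icc 0 L, ∀ s' ∈ Icc 0 L, s ≤ s' → |m s' - m s| ≤ ∫ x in s..s', g x) :
    m 0 ^ 3 ≤ 4 * m L ^ 3 + 64 * A * d⁻¹ * ∫ x in (0)..L, g x ^ 2 := by
  set t := chainTime d L with ht
  have htm : ∀ j, t j ∈ Icc 0 L := fun j => ⟨chainTime_nonneg hd.le hL j, chainTime_le d L j⟩
  obtain ⟨N, hN⟩ := exists_chainTime_eq (L := L) hd
  have hN' : t N = L := hN
  have ht0 : t 0 = 0 := chainTime_zero hL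
  set D : ℕ → ℝ := fun j => |m (t (j + 1)) - m (t j)| with hDdef
  have hD0 : ∀ j, 0 ≤ D j := fun j => abs_nonneg _
  -- telescoping: `m 0 ≤ m L + Σ D j`
  have htel : m 0 ≤ m L + ∑ j ∈ Finset.range N, D j := by
    have h1 : ∑ j ∈ Finset.range N, (m (t (j + 1)) - m (t j)) = m (t N) - m (t 0) :=
      Finset.sum_range_sub (fun j => m (t j)) N
    rw [hN', ht0] at h1
    have h2 : -(∑ j ∈ Finset.range N, (m (t (j + 1)) - m (t j))) ≤ ∑ j ∈ Finset.range N, D j := by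
      rw [← Finset.sum_neg_distrib]
      exact Finset.sum_le_sum fun j _ => by
        change -(m (t (j + 1)) - m (t j)) ≤ |m (t (j + 1)) - m (t j)|
        exact neg_le_abs _
    linarith
  -- the sup bound for each difference: `D j ≤ A (2ʲ d)⁻²`
  have hDsup : ∀ j, D j ≤ A / (2 ^ j * d) ^ 2 := by
    intro j
    rcases eq_or_lt_of_le (chainTime_le d L j) with hj | hj
    · -- stopped: both times equal `L`
      have hj1 : t (j + 1) = L := le_antisymm (chainTime_le d L _) (hj ▸ chainTime_le_succ hd.le j)
      rw [hDdef]; change |m (t (j + 1)) - m (t j)| ≤ _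
      rw [hj1, show t j = L from hj, sub_self, abs_zero]
      positivity
    · have hdt : d + t j = 2 ^ j * d := add_chainTime_eq_of_lt hj
      have h1 : m (t j) ≤ A / (2 ^ j * d) ^ 2 := by rw [← hdt]; exact hm2 _ (htm j)
      have h2 : m (t (j + 1)) ≤ A / (2 ^ j * d) ^ 2 := by
        refine (hm2 _ (htm (j + 1))).trans ?_
        rw [← hdt]
        refine div_le_div_of_nonneg_left hA (pow_pos (by linarith [(htm j).1]) 2) ?_
        exact pow_le_pow_left₀ (by linarith [(htm j).1]) (by linarith [chainTime_le_succ hd.le j (L := L)]) 2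
      rw [hDdef]; change |m (t (j + 1)) - m (t j)| ≤ _
      rw [abs_sub_le_iff]
      constructor <;> linarith [hm0 _ (htm j), hm0 _ (htm (j + 1))]
  -- the variation bound for each difference: `D j ^ 2 ≤ 2ʲ d ∫ g²`
  have hDvar : ∀ j, D j ^ 2 ≤ 2 ^ j * d * ∫ x in t j..t (j + 1), g x ^ 2 := by
    intro j
    have hjj : t j ≤ t (j + 1) := chainTime_le_succ hd.le j
    have hsub : Icc (t j) (t (j + 1)) ⊆ Icc 0 L := Icc_subset_Icc (htm j).1 (htm (j + 1)).2
    have h1 : D j ≤ ∫ x in t j..t (j + 1), g x := hm1 _ (htm j) _ (htm (j + 1)) hjj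
    have h2 := sq_intervalIntegral_le hjj (hg.mono hsub)
    have h3 : 0 ≤ ∫ x in t j..t (j + 1), g x ^ 2 := intervalIntegral.integral_nonneg hjj fun x _ => sq_nonneg _
    calc D j ^ 2 ≤ (∫ x in t j..t (j + 1), g x) ^ 2 := pow_le_pow_left₀ (hD0 j) h1 2
      _ ≤ (t (j + 1) - t j) * ∫ x in t j..t (j + 1), g x ^ 2 := h2
      _ ≤ 2 ^ j * d * ∫ x in t j..t (j + 1), g x ^ 2 :=
          mul_le_mul_of_nonneg_right (chainTime_succ_sub_le hd.le j) h3
  -- hence `2ʲ D j ^ 3 ≤ A d⁻¹ ∫ g²`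
  have hDcube : ∀ j, 2 ^ j * D j ^ 3 ≤ A * d⁻¹ * ∫ x in t j..t (j + 1), g x ^ 2 := by
    intro j
    have h3 : 0 ≤ ∫ x in t j..t (j + 1), g x ^ 2 :=
      intervalIntegral.integral_nonneg (chainTime_le_succ hd.le j) fun x _ => sq_nonneg _
    have e : (2 : ℝ) ^ j * D j ^ 3 = 2 ^ j * (D j * D j ^ 2) := by ring
    rw [e]
    calc (2 : ℝ) ^ j * (D j * D j ^ 2) ≤ 2 ^ j * (A / (2 ^ j * d) ^ 2 * (2 ^ j * d * ∫ x in t j..t (j + 1), g x ^ 2)) :=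
          mul_le_mul_of_nonneg_left (mul_le_mul (hDsup j) (hDvar j) (sq_nonneg _) (by positivity)) (by positivity)
      _ = A * d⁻¹ * ∫ x in t j..t (j + 1), g x ^ 2 := by
          field_simp
  -- sum over the chain
  have hsum : ∑ j ∈ Finset.range N, 2 ^ j * D j ^ 3 ≤ A * d⁻¹ * ∫ x in (0)..L, g x ^ 2 := by
    have hadj : ∑ j ∈ Finset.range N, ∫ x in t j..t (j + 1), g x ^ 2 = ∫ x in t 0..t N, g x ^ 2 := by
      refine intervalIntegral.sum_integral_adjacent_intervals fun j _ => ?_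
      have hsub : Icc (t j) (t (j + 1)) ⊆ Icc 0 L := Icc_subset_Icc (htm j).1 (htm (j + 1)).2
      exact ((hg.pow 2).mono (by rw [uIcc_of_le (chainTime_le_succ hd.le j)]; exact hsub)).intervalIntegrable
    rw [hN', ht0] at hadj
    calc ∑ j ∈ Finset.range N, 2 ^ j * D j ^ 3 ≤ ∑ j ∈ Finset.range N, A * d⁻¹ * ∫ x in t j..t (j + 1), g x ^ 2 :=
          Finset.sum_le_sum fun j _ => hDcube j
      _ = A * d⁻¹ * ∫ x in (0)..L, g x ^ 2 := by rw [← Finset.mul_sum, hadj]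
  -- assemble
  have hcube := cube_sum_le N hD0
  have hSD : 0 ≤ ∑ j ∈ Finset.range N, D j := Finset.sum_nonneg fun j _ => hD0 j
  have hmL : 0 ≤ m L := hm0 L ⟨hL, le_rfl⟩
  have hm00 : 0 ≤ m 0 := hm0 0 ⟨le_rfl, hL⟩
  calc m 0 ^ 3 ≤ (m L + ∑ j ∈ Finset.range N, D j) ^ 3 := pow_le_pow_left₀ hm00 htel 3
    _ ≤ 4 * m L ^ 3 + 4 * (∑ j ∈ Finset.range N, D j) ^ 3 := by
        nlinarith [sq_nonneg (m L - ∑ j ∈ Finset.range N, D j), mul_nonneg hmL hSD]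
    _ ≤ 4 * m L ^ 3 + 4 * (16 * (A * d⁻¹ * ∫ x in (0)..L, g x ^ 2)) := by
        nlinarith [hcube, hsum]
    _ = 4 * m L ^ 3 + 64 * A * d⁻¹ * ∫ x in (0)..L, g x ^ 2 := by ring

end OneDim

/-! ## The variation bound for a square root -/

section SqrtVar

/-- **Variation of `√A` from `|A'| ≤ 2√A g`.** If `A ≥ 0` has a continuous derivative `A'` on
`[s₁, s₂]` with `|A'| ≤ 2√A g` (`g ≥ 0` continuous), then `|√A(s₂) − √A(s₁)| ≤ ∫_{s₁}^{s₂} g`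
(differentiate `√(A + ε)` and let `ε → 0`). [folklore] -/
theorem abs_sqrt_sub_sqrt_le_integral {A A' g : ℝ → ℝ} {s₁ s₂ : ℝ} (h12 : s₁ ≤ s₂)
    (hA : ∀ s ∈ Icc s₁ s₂, HasDerivAt A (A' s) s) (hA0 : ∀ s ∈ Icc s₁ s₂, 0 ≤ A s)
    (hA'c : ContinuousOn A' (Icc s₁ s₂)) (hgc : ContinuousOn g (Icc s₁ s₂))
    (hg0 : ∀ s ∈ Icc s₁ s₂, 0 ≤ g s) (hb : ∀ s ∈ Icc s₁ s₂, |A' s| ≤ 2 * Real.sqrt (A s) * g s) :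
    |Real.sqrt (A s₂) - Real.sqrt (A s₁)| ≤ ∫ x in s₁..s₂, g x := by
  have hAc : ContinuousOn A (Icc s₁ s₂) := fun s hs => (hA s hs).continuousAt.continuousWithinAt
  -- the bound for every `ε > 0`
  have hε : ∀ ε : ℝ, 0 < ε → |Real.sqrt (A s₂ + ε) - Real.sqrt (A s₁ + ε)| ≤ ∫ x in s₁..s₂, g x := by
    intro ε hε
    have hpos : ∀ s ∈ Icc s₁ s₂, 0 < A s + ε := fun s hs => add_pos_of_nonneg_of_pos (hA0 s hs) hε
    have hB : ∀ s ∈ Icc s₁ s₂, HasDerivAt (fun s => Real.sqrt (A s + ε))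
        (A' s / (2 * Real.sqrt (A s + ε))) s := fun s hs =>
      ((hA s hs).add_const ε).sqrt (hpos s hs).ne'
    have hB'c : ContinuousOn (fun s => A' s / (2 * Real.sqrt (A s + ε))) (Icc s₁ s₂) :=
      hA'c.div (continuousOn_const.mul ((hAc.add continuousOn_const).sqrt)) fun s hs =>
        mul_ne_zero two_ne_zero (Real.sqrt_pos.2 (hpos s hs)).ne'
    have hB'i : IntervalIntegrable (fun s => A' s / (2 * Real.sqrt (A s + ε))) volume s₁ s₂ :=
      (hB'c.mono (by rw [uIcc_of_le h12])).intervalIntegrable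
    have hgi : IntervalIntegrable g volume s₁ s₂ := (hgc.mono (by rw [uIcc_of_le h12])).intervalIntegrable
    have hftc := intervalIntegral.integral_eq_sub_of_hasDerivAt (fun s hs => hB s (by rwa [uIcc_of_le h12] at hs)) hB'i
    rw [← hftc]
    have hbd : ∀ s ∈ Icc s₁ s₂, |A' s / (2 * Real.sqrt (A s + ε))| ≤ g s := by
      intro s hs
      have hs0 : 0 < Real.sqrt (A s + ε) := Real.sqrt_pos.2 (hpos s hs)
      have hle : Real.sqrt (A s) ≤ Real.sqrt (A s + ε) := Real.sqrt_le_sqrt (by linarith)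
      have hg0s : 0 ≤ g s := hg0 s hs
      rw [abs_div, abs_of_pos (by positivity : 0 < 2 * Real.sqrt (A s + ε)), div_le_iff₀ (by positivity)]
      calc |A' s| ≤ 2 * Real.sqrt (A s) * g s := hb s hs
        _ ≤ 2 * Real.sqrt (A s + ε) * g s := by nlinarith
        _ = g s * (2 * Real.sqrt (A s + ε)) := by ring
    calc |∫ x in s₁..s₂, A' x / (2 * Real.sqrt (A x + ε))|
        ≤ ∫ x in s₁..s₂, |A' x / (2 * Real.sqrt (A x + ε))| :=
          intervalIntegral.abs_integral_le_integral_abs h12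
      _ ≤ ∫ x in s₁..s₂, g x :=
          intervalIntegral.integral_mono_on h12 hB'i.abs hgi fun x hx => hbd x hx
  -- let `ε → 0`
  have hlim : Tendsto (fun ε => |Real.sqrt (A s₂ + ε) - Real.sqrt (A s₁ + ε)|) (𝓝[>] 0)
      (𝓝 |Real.sqrt (A s₂ + 0) - Real.sqrt (A s₁ + 0)|) := by
    refine ((Continuous.tendsto ?_ 0).mono_left nhdsWithin_le_nhds)
    exact ((Real.continuous_sqrt.comp (continuous_const.add continuous_id)).sub
      (Real.continuous_sqrt.comp (continuous_const.add continuous_id))).abs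
  rw [add_zero, add_zero] at hlim
  exact le_of_tendsto hlim (eventually_nhdsWithin_of_forall fun ε hε0 => hε ε hε0)

end SqrtVar

/-! ## Moving ball averages along a ray -/

section MovingAverage

/-- **Change of variables to the unit ball**: for `R > 0`,
`∫_{B̄(0,1)} G(z + Rv) dv = R⁻³ ∫_{B̄(z,R)} G`. [folklore] -/
theorem setIntegral_unitBall_comp_add_smul (G : ℝ³ → ℝ) (z : ℝ³) {R : ℝ} (hR : 0 < R) :
    ∫ v in closedBall (0 : ℝ³) 1, G (z + R • v) = R⁻¹ ^ 3 * ∫ x in closedBall z R, G x := by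
  rw [← MeasureTheory.integral_indicator measurableSet_closedBall,
    ← MeasureTheory.integral_indicator measurableSet_closedBall]
  -- `1_{B̄(0,1)}(v) G(z + Rv) = H(Rv)` with `H = 1_{B̄(0,R)} G(z + ·)`
  have h1 : (fun v => (closedBall (0 : ℝ³) 1).indicator (fun v => G (z + R • v)) v) =
      fun v => (closedBall (0 : ℝ³) R).indicator (fun w => G (z + w)) (R • v) := by
    funext v
    have hiff : v ∈ closedBall (0 : ℝ³) 1 ↔ R • v ∈ closedBall (0 : ℝ³) R := by
      rw [mem_closedBall, mem_closedBall, dist_zero_right, dist_zero_right, norm_smul, Real.norm_eq_abs,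
        abs_of_pos hR]
      constructor
      · intro h; nlinarith
      · intro h; nlinarith
    by_cases hv : v ∈ closedBall (0 : ℝ³) 1
    · rw [indicator_of_mem hv, indicator_of_mem (hiff.1 hv)]
    · rw [indicator_of_notMem hv, indicator_of_notMem (fun h => hv (hiff.2 h))]
  -- `1_{B̄(0,R)}(w) G(z + w) = K(z + w)` with `K = 1_{B̄(z,R)} G`
  have h2 : (fun w => (closedBall (0 : ℝ³) R).indicator (fun w => G (z + w)) w) =
      fun w => (closedBall z R).indicator G (z + w) := by
    funext w
    have hiff : w ∈ closedBall (0 : ℝ³) R ↔ z + w ∈ closedBall z R := by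
      rw [mem_closedBall, mem_closedBall, dist_zero_right, dist_eq_norm, add_sub_cancel_left]
    by_cases hw : w ∈ closedBall (0 : ℝ³) R
    · rw [indicator_of_mem hw, indicator_of_mem (hiff.1 hw)]
    · rw [indicator_of_notMem hw, indicator_of_notMem (fun h => hw (hiff.2 h))]
  rw [h1, Measure.integral_comp_smul volume (fun w => (closedBall (0 : ℝ³) R).indicator (fun w => G (z + w)) w) R,
    h2, integral_add_left_eq_self (fun x => (closedBall z R).indicator G x) z, finrank_euclideanSpace_fin,
    smul_eq_mul, abs_of_pos (by positivity), inv_pow]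

/-- **Cauchy–Schwarz on a compact set** for two continuous functions:
`∫_S f g ≤ √(∫_S f²) √(∫_S g²)` (`f, g ≥ 0`). [folklore] -/
theorem setIntegral_mul_le_sqrt_mul_sqrt {f g : ℝ³ → ℝ} (hf : Continuous f) (hg : Continuous g)
    (hf0 : ∀ x, 0 ≤ f x) (hg0 : ∀ x, 0 ≤ g x) {S : Set ℝ³} (hS : IsCompact S) :
    ∫ x in S, f x * g x ≤ Real.sqrt (∫ x in S, f x ^ 2) * Real.sqrt (∫ x in S, g x ^ 2) := by
  have hvol : volume S < ⊤ := hS.measure_lt_top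
  haveI : IsFiniteMeasure (volume.restrict S) := ⟨by rwa [Measure.restrict_apply_univ]⟩
  have hmem : ∀ {h : ℝ³ → ℝ}, Continuous h → MemLp h 2 (volume.restrict S) := by
    intro h hh
    obtain ⟨C, hC⟩ := hS.exists_bound_of_continuousOn hh.continuousOn
    exact MemLp.of_bound hh.aestronglyMeasurable C
      ((ae_restrict_iff' hS.measurableSet).2 (ae_of_all _ fun w hw => hC w hw))
  have h2 := integral_mul_le_Lp_mul_Lq_of_nonneg (μ := volume.restrict S) Real.HolderConjugate.two_two
    (ae_of_all _ hf0) (ae_of_all _ hg0) (by simpa using hmem hf) (by simpa using hmem hg)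
  simpa only [Real.rpow_two, one_div, Real.sqrt_eq_rpow] using h2

variable {ω : ℝ³ → ℝ³}

/-- The derivative of `|ω|²` is controlled by `2|ω| ‖Dω‖`. [folklore] -/
theorem norm_fderiv_norm_sq_le (hω : ContDiff ℝ 1 ω) (x : ℝ³) :
    ‖fderiv ℝ (fun x => ‖ω x‖ ^ 2) x‖ ≤ 2 * ‖ω x‖ * ‖fderiv ℝ ω x‖ := by
  have h := ((hω.differentiable one_ne_zero) x).hasFDerivAt.norm_sq
  rw [show (‖ω ·‖ ^ 2) = fun x => ‖ω x‖ ^ 2 from rfl] at h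
  rw [h.fderiv, two_smul]
  have hc : ‖(innerSL ℝ (ω x)).comp (fderiv ℝ ω x)‖ ≤ ‖ω x‖ * ‖fderiv ℝ ω x‖ :=
    (ContinuousLinearMap.opNorm_comp_le _ _).trans (le_of_eq (by rw [innerSL_apply_norm]))
  calc ‖(innerSL ℝ (ω x)).comp (fderiv ℝ ω x) + (innerSL ℝ (ω x)).comp (fderiv ℝ ω x)‖
      ≤ ‖(innerSL ℝ (ω x)).comp (fderiv ℝ ω x)‖ + ‖(innerSL ℝ (ω x)).comp (fderiv ℝ ω x)‖ := norm_add_le _ _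
    _ ≤ 2 * ‖ω x‖ * ‖fderiv ℝ ω x‖ := by linarith

/-- The point `y + s v₀ + c₁(d + s) v` of the moving ball (centre `y + s v₀` on the ray, radius
`c₁(d + s)`, `v` in the unit ball). [folklore] -/
def rayPoint (y v₀ : ℝ³) (c₁ d s : ℝ) (v : ℝ³) : ℝ³ := y + s • v₀ + (c₁ * (d + s)) • v

/-- Unfolding. [folklore] -/
theorem rayPoint_def (y v₀ : ℝ³) (c₁ d s : ℝ) (v : ℝ³) :
    rayPoint y v₀ c₁ d s v = y + s • v₀ + (c₁ * (d + s)) • v := rfl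

/-- The moving ball point is affine in `s`: `y + c₁ d v + s (v₀ + c₁ v)`. [folklore] -/
theorem rayPoint_eq (y v₀ : ℝ³) (c₁ d s : ℝ) (v : ℝ³) :
    rayPoint y v₀ c₁ d s v = (y + (c₁ * d) • v) + s • (v₀ + c₁ • v) := by
  rw [rayPoint_def, mul_add, add_smul, smul_add, smul_smul, mul_comm s c₁]
  abel

/-- Joint continuity of the moving ball point in `(s, v)`. [folklore] -/
theorem continuous_rayPoint (y v₀ : ℝ³) (c₁ d : ℝ) :
    Continuous fun q : ℝ × ℝ³ => rayPoint y v₀ c₁ d q.1 q.2 := by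
  simp only [rayPoint_def]
  fun_prop

/-- The speed of the moving ball point: `‖v₀ + c₁ v‖ ≤ 1 + c₁` on the unit ball (`‖v₀‖ ≤ 1`,
`c₁ ≥ 0`). [folklore] -/
theorem norm_rayVelocity_le {v₀ v : ℝ³} {c₁ : ℝ} (hv₀ : ‖v₀‖ ≤ 1) (hc₁ : 0 ≤ c₁)
    (hv : v ∈ closedBall (0 : ℝ³) 1) : ‖v₀ + c₁ • v‖ ≤ 1 + c₁ := by
  rw [mem_closedBall, dist_zero_right] at hv
  calc ‖v₀ + c₁ • v‖ ≤ ‖v₀‖ + ‖c₁ • v‖ := norm_add_le _ _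
    _ ≤ 1 + c₁ := by rw [norm_smul, Real.norm_eq_abs, abs_of_nonneg hc₁]; nlinarith

/-- **Differentiation of a moving ball average along the ray**: for `F ∈ C¹`,
`d/ds ∫_{B̄(0,1)} F(p(s, v)) dv = ∫_{B̄(0,1)} DF(p(s,v)) (v₀ + c₁v) dv`. [folklore] -/
theorem hasDerivAt_integral_unitBall_ray {F : ℝ³ → ℝ} (hF : ContDiff ℝ 1 F) (y v₀ : ℝ³) (c₁ d s₀ : ℝ) :
    HasDerivAt (fun s => ∫ v in closedBall (0 : ℝ³) 1, F (rayPoint y v₀ c₁ d s v))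
      (∫ v in closedBall (0 : ℝ³) 1, fderiv ℝ F (rayPoint y v₀ c₁ d s₀ v) (v₀ + c₁ • v)) s₀ := by
  have hFc : Continuous F := hF.continuous
  have hDFc : Continuous (fderiv ℝ F) := hF.continuous_fderiv one_ne_zero
  have hp := continuous_rayPoint y v₀ c₁ d
  have hps : ∀ s, Continuous fun v => rayPoint y v₀ c₁ d s v := fun s => hp.comp (Continuous.prodMk_right s)
  have hvel : Continuous fun v : ℝ³ => v₀ + c₁ • v := continuous_const.add (continuous_id.const_smul c₁)
  -- a uniform bound for `DF` on the relevant compact set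
  obtain ⟨Rbig, hRbig⟩ : ∃ Rbig : ℝ, Rbig = (|s₀| + 1) * ‖v₀‖ + |c₁| * (|d| + |s₀| + 1) := ⟨_, rfl⟩
  obtain ⟨K, hK⟩ := (isCompact_closedBall y Rbig).exists_bound_of_continuousOn hDFc.continuousOn
  have hmem : ∀ s ∈ ball s₀ 1, ∀ v ∈ closedBall (0 : ℝ³) 1, rayPoint y v₀ c₁ d s v ∈ closedBall y Rbig := by
    intro s hs v hv
    rw [mem_ball, Real.dist_eq] at hs
    rw [mem_closedBall, dist_zero_right] at hv
    rw [mem_closedBall, dist_eq_norm, rayPoint_def, add_assoc, add_sub_cancel_left]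
    have hs' : |s| ≤ |s₀| + 1 := by
      have := abs_sub_abs_le_abs_sub s s₀; linarith
    have hds : |d + s| ≤ |d| + |s₀| + 1 := (abs_add_le _ _).trans (by linarith)
    have h1 : ‖s • v₀‖ ≤ (|s₀| + 1) * ‖v₀‖ := by
      rw [norm_smul, Real.norm_eq_abs]; exact mul_le_mul_of_nonneg_right hs' (norm_nonneg _)
    have h2 : ‖(c₁ * (d + s)) • v‖ ≤ |c₁| * (|d| + |s₀| + 1) := by
      rw [norm_smul, Real.norm_eq_abs, abs_mul]
      calc |c₁| * |d + s| * ‖v‖ ≤ |c₁| * |d + s| * 1 := mul_le_mul_of_nonneg_left hv (by positivity)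
        _ ≤ |c₁| * (|d| + |s₀| + 1) := by rw [mul_one]; exact mul_le_mul_of_nonneg_left hds (abs_nonneg _)
    calc ‖s • v₀ + (c₁ * (d + s)) • v‖ ≤ ‖s • v₀‖ + ‖(c₁ * (d + s)) • v‖ := norm_add_le _ _
      _ ≤ (|s₀| + 1) * ‖v₀‖ + |c₁| * (|d| + |s₀| + 1) := add_le_add h1 h2
      _ = Rbig := hRbig.symm
  -- the hypotheses of the dominated differentiation lemma
  have h_meas : ∀ᶠ s in 𝓝 s₀, AEStronglyMeasurable (fun v => F (rayPoint y v₀ c₁ d s v))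
      (volume.restrict (closedBall (0 : ℝ³) 1)) :=
    Eventually.of_forall fun s => (hFc.comp (hps s)).aestronglyMeasurable
  have h_int : Integrable (fun v => F (rayPoint y v₀ c₁ d s₀ v)) (volume.restrict (closedBall (0 : ℝ³) 1)) :=
    (hFc.comp (hps s₀)).continuousOn.integrableOn_compact (isCompact_closedBall _ _)
  have h_meas' : AEStronglyMeasurable (fun v => fderiv ℝ F (rayPoint y v₀ c₁ d s₀ v) (v₀ + c₁ • v))
      (volume.restrict (closedBall (0 : ℝ³) 1)) :=
    ((hDFc.comp (hps s₀)).clm_apply hvel).aestronglyMeasurable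
  have h_bound : ∀ᵐ v ∂(volume.restrict (closedBall (0 : ℝ³) 1)), ∀ s ∈ ball s₀ 1,
      ‖fderiv ℝ F (rayPoint y v₀ c₁ d s v) (v₀ + c₁ • v)‖ ≤ |K| * (‖v₀‖ + |c₁|) := by
    refine (ae_restrict_iff' measurableSet_closedBall).2 (ae_of_all _ fun v hv s hs => ?_)
    have hv' : ‖v‖ ≤ 1 := by rwa [mem_closedBall, dist_zero_right] at hv
    have hvn : ‖v₀ + c₁ • v‖ ≤ ‖v₀‖ + |c₁| := by
      calc ‖v₀ + c₁ • v‖ ≤ ‖v₀‖ + ‖c₁ • v‖ := norm_add_le _ _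
        _ ≤ ‖v₀‖ + |c₁| := by
            rw [norm_smul, Real.norm_eq_abs]
            nlinarith [abs_nonneg c₁]
    calc ‖fderiv ℝ F (rayPoint y v₀ c₁ d s v) (v₀ + c₁ • v)‖
        ≤ ‖fderiv ℝ F (rayPoint y v₀ c₁ d s v)‖ * ‖v₀ + c₁ • v‖ := ContinuousLinearMap.le_opNorm _ _
      _ ≤ |K| * (‖v₀‖ + |c₁|) :=
          mul_le_mul ((hK _ (hmem s hs v hv)).trans (le_abs_self K)) hvn (norm_nonneg _) (abs_nonneg _)
  have h_bint : Integrable (fun _ : ℝ³ => |K| * (‖v₀‖ + |c₁|)) (volume.restrict (closedBall (0 : ℝ³) 1)) :=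
    integrableOn_const (hs := measure_closedBall_lt_top.ne) (hC := ENNReal.coe_ne_top)
  have h_diff : ∀ᵐ v ∂(volume.restrict (closedBall (0 : ℝ³) 1)), ∀ s ∈ ball s₀ 1,
      HasDerivAt (fun s => F (rayPoint y v₀ c₁ d s v)) (fderiv ℝ F (rayPoint y v₀ c₁ d s v) (v₀ + c₁ • v)) s := by
    refine ae_of_all _ fun v s _ => ?_
    have hpath : HasDerivAt (fun s : ℝ => rayPoint y v₀ c₁ d s v) (v₀ + c₁ • v) s := by
      have h1 : HasDerivAt (fun s : ℝ => (y + (c₁ * d) • v) + s • (v₀ + c₁ • v)) ((1 : ℝ) • (v₀ + c₁ • v)) s :=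
        ((hasDerivAt_id s).smul_const (v₀ + c₁ • v)).const_add _
      rw [one_smul] at h1
      refine h1.congr_of_eventuallyEq (Eventually.of_forall fun s' => ?_)
      exact rayPoint_eq y v₀ c₁ d s' v
    exact ((hF.differentiable one_ne_zero) _).hasFDerivAt.comp_hasDerivAt s hpath
  exact (hasDerivAt_integral_of_dominated_loc_of_deriv_le (ball_mem_nhds s₀ one_pos) h_meas h_int h_meas'
    h_bound h_bint h_diff).2

/-- Continuity in `s` of a moving ball integral with jointly continuous integrand. [folklore] -/
theorem continuous_integral_unitBall_ray {Φ : ℝ³ → ℝ³ → ℝ} (hΦ : Continuous (uncurry Φ))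
    (y v₀ : ℝ³) (c₁ d : ℝ) :
    Continuous fun s : ℝ => ∫ v in closedBall (0 : ℝ³) 1, Φ (rayPoint y v₀ c₁ d s v) v := by
  have h : Continuous (uncurry fun (s : ℝ) (v : ℝ³) => Φ (rayPoint y v₀ c₁ d s v) v) :=
    hΦ.comp ((continuous_rayPoint y v₀ c₁ d).prodMk continuous_snd)
  exact continuous_parametric_integral_of_continuous h (isCompact_closedBall 0 1)

/-- **The variation bound for the moving root-mean-square** of `|ω|` along the ray: with
`A(s) = V⁻¹ ∫_{B̄(0,1)} |ω(p(s,v))|²` and `G(s) = V⁻¹ ∫_{B̄(0,1)} ‖Dω(p(s,v))‖²`,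
`|√A(s') − √A(s)| ≤ ∫ₛ^{s'} (1 + c₁) √G` (differentiate under the integral, `|D|ω|²| ≤ 2|ω|‖Dω‖`,
Cauchy–Schwarz, and the square-root variation lemma). This replaces the Poincaré comparison
(10.24) of adjacent Whitney averages. [cite: Tao2011, §10, proof of Thm. 10.1 ((10.24), the comparison of adjacent averages)] -/
theorem abs_sqrt_ballMean_sub_le (hω : ContDiff ℝ 1 ω) {y v₀ : ℝ³} {c₁ d : ℝ} (hv₀ : ‖v₀‖ ≤ 1)
    (hc₁ : 0 ≤ c₁) {s₁ s₂ : ℝ} (h12 : s₁ ≤ s₂) :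
    |Real.sqrt ((volume.real (closedBall (0 : ℝ³) 1))⁻¹ *
          ∫ v in closedBall (0 : ℝ³) 1, ‖ω (rayPoint y v₀ c₁ d s₂ v)‖ ^ 2) -
        Real.sqrt ((volume.real (closedBall (0 : ℝ³) 1))⁻¹ *
          ∫ v in closedBall (0 : ℝ³) 1, ‖ω (rayPoint y v₀ c₁ d s₁ v)‖ ^ 2)| ≤
      ∫ s in s₁..s₂, (1 + c₁) * Real.sqrt ((volume.real (closedBall (0 : ℝ³) 1))⁻¹ *
        ∫ v in closedBall (0 : ℝ³) 1, ‖fderiv ℝ ω (rayPoint y v₀ c₁ d s v)‖ ^ 2) := by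
  set V : ℝ := volume.real (closedBall (0 : ℝ³) 1) with hV
  have hV0 : 0 < V := by
    rw [hV, Measure.real, ENNReal.toReal_pos_iff]
    exact ⟨measure_closedBall_pos volume _ one_pos, measure_closedBall_lt_top⟩
  set F : ℝ³ → ℝ := fun x => ‖ω x‖ ^ 2 with hFdef
  have hF : ContDiff ℝ 1 F := hω.norm_sq (𝕜 := ℝ)
  have hp := continuous_rayPoint y v₀ c₁ d
  have hωc : Continuous ω := hω.continuous
  have hDωc : Continuous (fderiv ℝ ω) := hω.continuous_fderiv one_ne_zero
  have hDFc : Continuous (fderiv ℝ F) := hF.continuous_fderiv one_ne_zero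
  -- the three functions of `s`
  set Af : ℝ → ℝ := fun s => V⁻¹ * ∫ v in closedBall (0 : ℝ³) 1, F (rayPoint y v₀ c₁ d s v) with hAf
  set Af' : ℝ → ℝ := fun s => V⁻¹ * ∫ v in closedBall (0 : ℝ³) 1,
    fderiv ℝ F (rayPoint y v₀ c₁ d s v) (v₀ + c₁ • v) with hAf'
  set Gf : ℝ → ℝ := fun s => V⁻¹ * ∫ v in closedBall (0 : ℝ³) 1, ‖fderiv ℝ ω (rayPoint y v₀ c₁ d s v)‖ ^ 2
    with hGf
  have hderiv : ∀ s, HasDerivAt Af (Af' s) s := fun s =>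
    (hasDerivAt_integral_unitBall_ray hF y v₀ c₁ d s).const_mul V⁻¹
  have hA0 : ∀ s, 0 ≤ Af s := fun s =>
    mul_nonneg (inv_nonneg.2 hV0.le) (setIntegral_nonneg measurableSet_closedBall fun v _ => sq_nonneg _)
  have hG0 : ∀ s, 0 ≤ Gf s := fun s =>
    mul_nonneg (inv_nonneg.2 hV0.le) (setIntegral_nonneg measurableSet_closedBall fun v _ => sq_nonneg _)
  have hAf'c : Continuous Af' := continuous_const.mul (continuous_integral_unitBall_ray
    (Φ := fun x v => fderiv ℝ F x (v₀ + c₁ • v))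
    ((hDFc.comp continuous_fst).clm_apply (continuous_const.add (continuous_snd.const_smul c₁)))
    y v₀ c₁ d)
  have hGfc : Continuous Gf := continuous_const.mul (continuous_integral_unitBall_ray
    (Φ := fun x _ => ‖fderiv ℝ ω x‖ ^ 2) ((hDωc.comp continuous_fst).norm.pow 2) y v₀ c₁ d)
  -- the key pointwise bound `|A'| ≤ 2 √A (1 + c₁) √G`
  have hbound : ∀ s, |Af' s| ≤ 2 * Real.sqrt (Af s) * ((1 + c₁) * Real.sqrt (Gf s)) := by
    intro s
    have hi1 : ∀ v, ‖fderiv ℝ F (rayPoint y v₀ c₁ d s v) (v₀ + c₁ • v)‖ ≤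
        (closedBall (0 : ℝ³) 1).indicator (fun v => 2 * (1 + c₁) *
          (‖ω (rayPoint y v₀ c₁ d s v)‖ * ‖fderiv ℝ ω (rayPoint y v₀ c₁ d s v)‖)) v +
        (closedBall (0 : ℝ³) 1)ᶜ.indicator (fun v => ‖fderiv ℝ F (rayPoint y v₀ c₁ d s v) (v₀ + c₁ • v)‖) v := by
      intro v
      by_cases hv : v ∈ closedBall (0 : ℝ³) 1
      · rw [indicator_of_mem hv, indicator_of_notMem (Set.notMem_compl_iff.mpr hv), add_zero]
        calc ‖fderiv ℝ F (rayPoint y v₀ c₁ d s v) (v₀ + c₁ • v)‖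
            ≤ ‖fderiv ℝ F (rayPoint y v₀ c₁ d s v)‖ * ‖v₀ + c₁ • v‖ := ContinuousLinearMap.le_opNorm _ _
          _ ≤ (2 * ‖ω (rayPoint y v₀ c₁ d s v)‖ * ‖fderiv ℝ ω (rayPoint y v₀ c₁ d s v)‖) * (1 + c₁) :=
              mul_le_mul (norm_fderiv_norm_sq_le hω _) (norm_rayVelocity_le hv₀ hc₁ hv) (norm_nonneg _) (by positivity)
          _ = 2 * (1 + c₁) * (‖ω (rayPoint y v₀ c₁ d s v)‖ * ‖fderiv ℝ ω (rayPoint y v₀ c₁ d s v)‖) := by ring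
      · rw [indicator_of_notMem hv, indicator_of_mem (Set.mem_compl hv), zero_add]
    have hint_prod : IntegrableOn (fun v => ‖ω (rayPoint y v₀ c₁ d s v)‖ * ‖fderiv ℝ ω (rayPoint y v₀ c₁ d s v)‖)
        (closedBall (0 : ℝ³) 1) volume :=
      (((hωc.comp (hp.comp (Continuous.prodMk_right s))).norm.mul
        (hDωc.comp (hp.comp (Continuous.prodMk_right s))).norm).continuousOn.integrableOn_compact
          (isCompact_closedBall _ _))
    have h1 : |∫ v in closedBall (0 : ℝ³) 1, fderiv ℝ F (rayPoint y v₀ c₁ d s v) (v₀ + c₁ • v)| ≤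
        2 * (1 + c₁) * ∫ v in closedBall (0 : ℝ³) 1,
          ‖ω (rayPoint y v₀ c₁ d s v)‖ * ‖fderiv ℝ ω (rayPoint y v₀ c₁ d s v)‖ := by
      rw [← Real.norm_eq_abs, ← MeasureTheory.integral_const_mul]
      refine (MeasureTheory.norm_integral_le_integral_norm _).trans (setIntegral_mono_on ?_ (hint_prod.const_mul _)
        measurableSet_closedBall fun v hv => ?_)
      · exact ((hDFc.comp (hp.comp (Continuous.prodMk_right s))).clm_apply
          (continuous_const.add (continuous_id.const_smul c₁))).norm.continuousOn.integrableOn_compact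
            (isCompact_closedBall _ _)
      · have := hi1 v
        rwa [indicator_of_mem hv, indicator_of_notMem (Set.notMem_compl_iff.mpr hv), add_zero] at this
    have hf1 : Continuous fun v => ‖ω (rayPoint y v₀ c₁ d s v)‖ := (hωc.comp (hp.comp (Continuous.prodMk_right s))).norm
    have hf2 : Continuous fun v => ‖fderiv ℝ ω (rayPoint y v₀ c₁ d s v)‖ :=
      (hDωc.comp (hp.comp (Continuous.prodMk_right s))).norm
    have h2 := setIntegral_mul_le_sqrt_mul_sqrt hf1 hf2 (fun _ => norm_nonneg _) (fun _ => norm_nonneg _)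
      (isCompact_closedBall (0 : ℝ³) 1)
    have hsq : ∀ (I : ℝ), 0 ≤ I → Real.sqrt I = Real.sqrt V * Real.sqrt (V⁻¹ * I) := fun I hI => by
      rw [← Real.sqrt_mul hV0.le, ← mul_assoc, mul_inv_cancel₀ hV0.ne', one_mul]
    have hIω : 0 ≤ ∫ v in closedBall (0 : ℝ³) 1, ‖ω (rayPoint y v₀ c₁ d s v)‖ ^ 2 :=
      setIntegral_nonneg measurableSet_closedBall fun v _ => sq_nonneg _
    have hID : 0 ≤ ∫ v in closedBall (0 : ℝ³) 1, ‖fderiv ℝ ω (rayPoint y v₀ c₁ d s v)‖ ^ 2 :=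
      setIntegral_nonneg measurableSet_closedBall fun v _ => sq_nonneg _
    change |V⁻¹ * ∫ v in closedBall (0 : ℝ³) 1, fderiv ℝ F (rayPoint y v₀ c₁ d s v) (v₀ + c₁ • v)| ≤
      2 * Real.sqrt (V⁻¹ * ∫ v in closedBall (0 : ℝ³) 1, F (rayPoint y v₀ c₁ d s v)) *
        ((1 + c₁) * Real.sqrt (V⁻¹ * ∫ v in closedBall (0 : ℝ³) 1, ‖fderiv ℝ ω (rayPoint y v₀ c₁ d s v)‖ ^ 2))
    rw [abs_mul, abs_of_pos (inv_pos.2 hV0)]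
    have h3 := h1.trans (mul_le_mul_of_nonneg_left h2 (by positivity))
    simp only [hFdef] at h3 ⊢
    rw [hsq _ hIω, hsq _ hID] at h3
    have hsV : Real.sqrt V * Real.sqrt V = V := Real.mul_self_sqrt hV0.le
    have hVi : 0 < V⁻¹ := inv_pos.2 hV0
    calc V⁻¹ * |∫ v in closedBall (0 : ℝ³) 1, fderiv ℝ (fun x => ‖ω x‖ ^ 2) (rayPoint y v₀ c₁ d s v) (v₀ + c₁ • v)|
        ≤ V⁻¹ * (2 * (1 + c₁) * (Real.sqrt V * Real.sqrt (V⁻¹ * ∫ v in closedBall (0 : ℝ³) 1, ‖ω (rayPoint y v₀ c₁ d s v)‖ ^ 2) *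
            (Real.sqrt V * Real.sqrt (V⁻¹ * ∫ v in closedBall (0 : ℝ³) 1, ‖fderiv ℝ ω (rayPoint y v₀ c₁ d s v)‖ ^ 2)))) :=
          mul_le_mul_of_nonneg_left h3 hVi.le
      _ = 2 * Real.sqrt (V⁻¹ * ∫ v in closedBall (0 : ℝ³) 1, ‖ω (rayPoint y v₀ c₁ d s v)‖ ^ 2) *
            ((1 + c₁) * Real.sqrt (V⁻¹ * ∫ v in closedBall (0 : ℝ³) 1, ‖fderiv ℝ ω (rayPoint y v₀ c₁ d s v)‖ ^ 2)) := by
          rw [show ∀ (X Y : ℝ), V⁻¹ * (2 * (1 + c₁) * (Real.sqrt V * X * (Real.sqrt V * Y))) =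
            (V⁻¹ * (Real.sqrt V * Real.sqrt V)) * (2 * X * ((1 + c₁) * Y)) from fun X Y => by ring,
            hsV, inv_mul_cancel₀ hV0.ne', one_mul]
  have h := abs_sqrt_sub_sqrt_le_integral h12 (fun s _ => hderiv s) (fun s _ => hA0 s) hAf'c.continuousOn
    ((continuous_const.mul (Real.continuous_sqrt.comp hGfc)).continuousOn)
    (fun s _ => mul_nonneg (by linarith) (Real.sqrt_nonneg _)) (fun s _ => hbound s)
  exact h

/-- **The chain bound for one ray** (Tao's parent-ball chain from a small Whitney ball up to a
large one, in continuous form). For `ω ∈ C¹(ℝ³; ℝ³)`, a ray `s ↦ y + s v₀` (`‖v₀‖ ≤ 1`) with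
moving balls `B̄(y + s v₀, c₁(d + s))` (`c₁ ≥ 0`, `d > 0`), write
`m(s) = (V⁻¹ ∫_{B̄(0,1)} |ω(p(s,v))|² dv)^{1/2}` and `G(s) = V⁻¹ ∫_{B̄(0,1)} ‖Dω(p(s,v))‖² dv`
(`V = vol B̄(0,1)`). If the sup bound `m(s) ≤ A/(d + s)²` holds on `[0, L]` (in the application:
(10.23)), then `m(0)³ ≤ 4 m(L)³ + 64 A d⁻¹ ∫₀ᴸ (1 + c₁)² G(s) ds`. [cite: Tao2011, §10, proof of Thm. 10.1 (the chaining argument, pp. 32–33)] -/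
theorem ray_chain_cube_le (hω : ContDiff ℝ 1 ω) {y v₀ : ℝ³} {c₁ d L A : ℝ} (hv₀ : ‖v₀‖ ≤ 1)
    (hc₁ : 0 ≤ c₁) (hd : 0 < d) (hL : 0 ≤ L) (hA : 0 ≤ A)
    (hsup : ∀ s ∈ Icc 0 L, Real.sqrt ((volume.real (closedBall (0 : ℝ³) 1))⁻¹ *
      ∫ v in closedBall (0 : ℝ³) 1, ‖ω (rayPoint y v₀ c₁ d s v)‖ ^ 2) ≤ A / (d + s) ^ 2) :
    Real.sqrt ((volume.real (closedBall (0 : ℝ³) 1))⁻¹ *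
        ∫ v in closedBall (0 : ℝ³) 1, ‖ω (rayPoint y v₀ c₁ d 0 v)‖ ^ 2) ^ 3 ≤
      4 * Real.sqrt ((volume.real (closedBall (0 : ℝ³) 1))⁻¹ *
          ∫ v in closedBall (0 : ℝ³) 1, ‖ω (rayPoint y v₀ c₁ d L v)‖ ^ 2) ^ 3 +
        64 * A * d⁻¹ * ∫ s in (0)..L, (1 + c₁) ^ 2 * ((volume.real (closedBall (0 : ℝ³) 1))⁻¹ *
          ∫ v in closedBall (0 : ℝ³) 1, ‖fderiv ℝ ω (rayPoint y v₀ c₁ d s v)‖ ^ 2) := by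
  set V : ℝ := volume.real (closedBall (0 : ℝ³) 1) with hV
  have hV0 : 0 < V := by
    rw [hV, Measure.real, ENNReal.toReal_pos_iff]
    exact ⟨measure_closedBall_pos volume _ one_pos, measure_closedBall_lt_top⟩
  have hp := continuous_rayPoint y v₀ c₁ d
  have hDωc : Continuous (fderiv ℝ ω) := hω.continuous_fderiv one_ne_zero
  -- the two functions of `s`
  set m : ℝ → ℝ := fun s => Real.sqrt (V⁻¹ * ∫ v in closedBall (0 : ℝ³) 1, ‖ω (rayPoint y v₀ c₁ d s v)‖ ^ 2)
    with hm
  set Gf : ℝ → ℝ := fun s => V⁻¹ * ∫ v in closedBall (0 : ℝ³) 1, ‖fderiv ℝ ω (rayPoint y v₀ c₁ d s v)‖ ^ 2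
    with hGf
  have hG0 : ∀ s, 0 ≤ Gf s := fun s =>
    mul_nonneg (inv_nonneg.2 hV0.le) (setIntegral_nonneg measurableSet_closedBall fun v _ => sq_nonneg _)
  have hGfc : Continuous Gf := continuous_const.mul (continuous_integral_unitBall_ray
    (Φ := fun x _ => ‖fderiv ℝ ω x‖ ^ 2) ((hDωc.comp continuous_fst).norm.pow 2) y v₀ c₁ d)
  have hgc : Continuous fun s => (1 + c₁) * Real.sqrt (Gf s) :=
    continuous_const.mul (Real.continuous_sqrt.comp hGfc)
  have key := chain_cube_le (m := m) (g := fun s => (1 + c₁) * Real.sqrt (Gf s)) hd hL hA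
    (fun s _ => Real.sqrt_nonneg _) hsup hgc.continuousOn
    (fun s _ s' _ hss' => abs_sqrt_ballMean_sub_le hω hv₀ hc₁ hss')
  have e : ∫ s in (0)..L, ((1 + c₁) * Real.sqrt (Gf s)) ^ 2 = ∫ s in (0)..L, (1 + c₁) ^ 2 * Gf s :=
    intervalIntegral.integral_congr fun s _ => by
      rw [mul_pow, Real.sq_sqrt (hG0 s)]
  rw [e] at key
  exact key

end MovingAverage

end Literature.Analysis.FluidPDE

end
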